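import Summits.AtomisticToContinuum.HydrodynamicLimit.Theorems.JParityClosureLocalSecondLawContactCondLaw
import Summits.AtomisticToContinuum.HydrodynamicLimit.Theorems.DenseExcursion.Negative.AtTimeZero

/-!
# Stub B′ (`stub_initialMatching`) of the line `contact-asymmetry-information` for the crux `LocalSecondLaw`
(stmt-AtomisticToContinuum-13081) — part 7: identification of the Euler data at `t = 0` with the local Gibbs profiles

Step (iii) of the initial matching: below the statics threshold of the tree's law of large numbers for local Gibbs
states (`localGibbs_lln_holds`), every CONTINUOUS field triple `(ρ, u, θ)(0, ·)` tied at `t = 0` to the local Gibbs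
laws by `TendstoHydroFieldsAt … 0` satisfies `ρ(0,·) > 0`, `u(0,·) = u₀` and `θ(0,·) = θ₀` (`contactB_data_zero_eq`):
limits in probability are unique (`DenseExcursionAtTimeZero.eq_of_tendsto_measure_lt_abs` and its vector-valued twin
`contactB_eq_of_tendsto_measure_lt_norm`), continuous (vector) fields with equal integrals against all continuous
scalar tests agree (`DenseExcursionAtTimeZero.eq_of_forall_integral_mul_eq`, `contactB_eq_of_forall_integral_smul_eq`),
and the positive limit density cancels.  Companion of `DenseExcursionAtTimeZero.density_zero_eq_rhoLim` (density);
used by B′ to replace the Maxwellian parameters `(u₀, θ₀)` of the local Gibbs law by the Euler datum `(u, θ)(0,·)`.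

References: H. Spohn, *Large Scale Dynamics of Interacting Particles* (1991), Part I §2.3 (law of large numbers for
local equilibrium states).
-/

noncomputable section

open scoped BigOperators Topology Classical MeasureTheory ENNReal InnerProductSpace
open Filter Set MeasureTheory Function
open Literature.MathematicalPhysics.KineticTheory
open Literature.Analysis.FluidPDE
open Summit.AtomisticToContinuum.HydrodynamicLimit.Theorems.LocalSecondLawNegative
open Summit.AtomisticToContinuum.HydrodynamicLimit.Theorems.LocalSecondLawLedger

namespace Summit.AtomisticToContinuum.HydrodynamicLimit.Theorems.LocalSecondLawContact

/-- Limits in probability are unique (vector-valued observables, eventually-probability laws). -/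
theorem contactB_eq_of_tendsto_measure_lt_norm :
    ∀ {E : Type*} [NormedAddCommGroup E] {Ω : ℕ → Type*} [∀ N, MeasurableSpace (Ω N)]
      {P : (N : ℕ) → Measure (Ω N)}, (∀ᶠ N in atTop, IsProbabilityMeasure (P N)) →
      ∀ {F : (N : ℕ) → Ω N → E} {a b : E},
      (∀ δ > (0 : ℝ), Tendsto (fun N => P N {z | δ < ‖F N z - a‖}) atTop (𝓝 0)) →
      (∀ δ > (0 : ℝ), Tendsto (fun N => P N {z | δ < ‖F N z - b‖}) atTop (𝓝 0)) → a = b := by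
  intro E _ Ω _ P hP F a b ha hb
  by_contra hab
  have hd : 0 < ‖a - b‖ := norm_pos_iff.2 (sub_ne_zero.2 hab)
  set δ := ‖a - b‖ / 3 with hδ
  have hδ0 : 0 < δ := by positivity
  have hcover : ∀ N, (univ : Set (Ω N)) ⊆ {z | δ < ‖F N z - a‖} ∪ {z | δ < ‖F N z - b‖} := by
    intro N z _
    by_contra hz
    simp only [Set.mem_union, Set.mem_setOf_eq, not_or, not_lt] at hz
    have : ‖a - b‖ ≤ ‖F N z - a‖ + ‖F N z - b‖ := by
      calc ‖a - b‖ = ‖(F N z - b) - (F N z - a)‖ := by congr 1; abel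
        _ ≤ ‖F N z - b‖ + ‖F N z - a‖ := norm_sub_le _ _
        _ = ‖F N z - a‖ + ‖F N z - b‖ := add_comm _ _
    linarith [hz.1, hz.2]
  have hle : ∀ᶠ N in atTop, (1 : ℝ≥0∞) ≤ P N {z | δ < ‖F N z - a‖} + P N {z | δ < ‖F N z - b‖} := by
    filter_upwards [hP] with N hPN
    calc (1 : ℝ≥0∞) = P N univ := measure_univ.symm
      _ ≤ P N ({z | δ < ‖F N z - a‖} ∪ {z | δ < ‖F N z - b‖}) := measure_mono (hcover N)
      _ ≤ _ := measure_union_le _ _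
  have hlim : Tendsto (fun N => P N {z | δ < ‖F N z - a‖} + P N {z | δ < ‖F N z - b‖}) atTop (𝓝 0) := by
    simpa using (ha δ hδ0).add (hb δ hδ0)
  exact absurd (ge_of_tendsto hlim hle) (by simp)

/-- Two continuous vector fields on `𝕋³` with equal integrals against every continuous scalar test function are equal. -/
theorem contactB_eq_of_forall_integral_smul_eq :
    ∀ {f g : T3 → V3}, Continuous f → Continuous g →
      (∀ χ : T3 → ℝ, Continuous χ → ∫ x, χ x • f x = ∫ x, χ x • g x) → f = g := by
  intro f g hf hg h
  have hw : Continuous fun x => f x - g x := hf.sub hg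
  have key : ∀ e : V3, ∀ x, ⟪e, f x - g x⟫_ℝ = 0 := by
    intro e
    set χ : T3 → ℝ := fun x => ⟪e, f x - g x⟫_ℝ with hχ
    have hχc : Continuous χ := continuous_const.inner hw
    have hi1 : Integrable (fun x => χ x • f x) := integrable_of_continuous_T3 (hχc.smul hf)
    have hi2 : Integrable (fun x => χ x • g x) := integrable_of_continuous_T3 (hχc.smul hg)
    have h0 : ∫ x, χ x • (f x - g x) = 0 := by
      simp_rw [smul_sub]
      rw [integral_sub hi1 hi2, h χ hχc, sub_self]
    have hsq : ∫ x, χ x ^ 2 = 0 := by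
      have h1 : ⟪e, ∫ x, χ x • (f x - g x)⟫_ℝ = 0 := by rw [h0, inner_zero_right]
      have hi3 : Integrable (fun x => χ x • (f x - g x)) := integrable_of_continuous_T3 (hχc.smul hw)
      rw [← integral_inner hi3] at h1
      have h2 : (fun x => ⟪e, χ x • (f x - g x)⟫_ℝ) = fun x => χ x ^ 2 := by
        funext x
        rw [inner_smul_right]
        show χ x * χ x = χ x ^ 2
        ring
      rwa [h2] at h1
    have hae : (fun x => χ x ^ 2) =ᵐ[volume] 0 :=
      (integral_eq_zero_iff_of_nonneg (fun x => sq_nonneg (χ x)) (integrable_of_continuous_T3 (hχc.pow 2))).1 hsq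
    have heq : (fun x => χ x ^ 2) = 0 := (Continuous.ae_eq_iff_eq volume (hχc.pow 2) continuous_const).1 hae
    intro x
    have hx := congrFun heq x
    simp only [Pi.zero_apply, ne_eq, OfNat.ofNat_ne_zero, not_false_eq_true, pow_eq_zero_iff] at hx
    exact hx
  funext x
  have h1 : ⟪f x - g x, f x - g x⟫_ℝ = 0 := key (f x - g x) x
  rw [inner_self_eq_zero, sub_eq_zero] at h1
  exact h1

/-- **Identification of the Euler data at `t = 0`** (B′ (iii′)): below a threshold `σ₁(a₀,θ₀,u₀) ≤ 1/2`, any continuous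
field triple tied at `t = 0` to the local Gibbs laws has `u(0,·) = u₀`, `θ(0,·) = θ₀` and `ρ(0,·) = rhoLim` (the tree's
statics LLN `localGibbs_lln_holds` supplies the limits `(ρ₀′, u₀, θ₀)`; limits in probability are unique; continuous
fields with equal integrals against all continuous tests agree; `ρ(0) = ρ₀′ > 0` cancels). -/
theorem contactB_data_zero_eq :
    ∀ (a₀ θ₀ : T3 → ℝ) (u₀ : T3 → V3), Continuous a₀ → Continuous θ₀ → Continuous u₀ →
      (∀ x, 0 < a₀ x) → (∀ x, 0 < θ₀ x) →
      ∃ σ₁ : ℝ, 0 < σ₁ ∧ ∀ σ : ℝ, 0 < σ → σ < σ₁ →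
        ∀ (ρ θ : ℝ → T3 → ℝ) (u : ℝ → T3 → V3) (Φ : (N : ℕ) → Flow σ N),
          Continuous (ρ 0) → Continuous (u 0) → Continuous (θ 0) →
          TendstoHydroFieldsAt (fun N => localGibbsLaw σ a₀ u₀ θ₀ N (Φ N)) Φ ρ u θ 0 →
          (∀ x, 0 < ρ 0 x) ∧ u 0 = u₀ ∧ θ 0 = θ₀ := by
  intro a₀ θ₀ u₀ ha hθ hu ha0 hθ0
  obtain ⟨σ₀, hσ₀, H⟩ := localGibbs_lln_holds a₀ θ₀ u₀ ha hθ hu ha0 hθ0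
  refine ⟨σ₀, hσ₀, fun σ hσ hσlt ρ θ u Φ hρc huc hθc hT => ?_⟩
  obtain ⟨ρ₀', hρc', hρ0', HΦ⟩ := H σ hσ hσlt
  obtain ⟨hprob, hT'⟩ := HΦ Φ
  set P : (N : ℕ) → Measure (Phase N) := fun N => localGibbsLaw σ a₀ u₀ θ₀ N (Φ N)
  have hP : ∀ᶠ N in atTop, IsProbabilityMeasure (P N) := Eventually.of_forall hprob
  -- density
  have hρ : ρ 0 = ρ₀' := by
    refine DenseExcursionAtTimeZero.eq_of_forall_integral_mul_eq hρc hρc' fun χ hχ => ?_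
    exact DenseExcursionAtTimeZero.eq_of_tendsto_measure_lt_abs (P := P)
      (F := fun N z => empiricalDensityField ((Φ N).flow 0 z) χ) hP
      (fun δ hδ => (hT χ hχ δ hδ).1) (fun δ hδ => (hT' χ hχ δ hδ).1)
  have hρpos : ∀ x, 0 < ρ 0 x := fun x => by rw [hρ]; exact hρ0' x
  -- momentum
  have hm : (fun x => ρ 0 x • u 0 x) = fun x => ρ₀' x • u₀ x := by
    refine contactB_eq_of_forall_integral_smul_eq (hρc.smul huc) (hρc'.smul hu) fun χ hχ => ?_
    have e := contactB_eq_of_tendsto_measure_lt_norm (P := P)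
      (F := fun N z => empiricalMomentumField ((Φ N).flow 0 z) χ) hP
      (fun δ hδ => (hT χ hχ δ hδ).2.1) (fun δ hδ => (hT' χ hχ δ hδ).2.1)
    have h1 : (fun x => χ x • (ρ 0 x • u 0 x)) = fun x => (χ x * ρ 0 x) • u 0 x := by
      funext x; rw [mul_smul]
    have h2 : (fun x => χ x • (ρ₀' x • u₀ x)) = fun x => (χ x * ρ₀' x) • u₀ x := by
      funext x; rw [mul_smul]
    rw [h1, h2]
    exact e
  have hu0 : u 0 = u₀ := by
    funext x
    have hx : ρ 0 x • u 0 x = ρ₀' x • u₀ x := congrFun hm x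
    rw [hρ] at hx
    exact smul_right_injective V3 (hρ0' x).ne' hx
  -- energy
  have hE : (fun x => totalEnergyDensity (ρ 0 x) (u 0 x) (θ 0 x)) =
      fun x => totalEnergyDensity (ρ₀' x) (u₀ x) (θ₀ x) := by
    have hEc : Continuous fun x => totalEnergyDensity (ρ 0 x) (u 0 x) (θ 0 x) := by
      unfold totalEnergyDensity; fun_prop
    have hEc' : Continuous fun x => totalEnergyDensity (ρ₀' x) (u₀ x) (θ₀ x) := by
      unfold totalEnergyDensity; fun_prop
    refine DenseExcursionAtTimeZero.eq_of_forall_integral_mul_eq hEc hEc' fun χ hχ => ?_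
    exact DenseExcursionAtTimeZero.eq_of_tendsto_measure_lt_abs (P := P)
      (F := fun N z => empiricalEnergyField ((Φ N).flow 0 z) χ) hP
      (fun δ hδ => (hT χ hχ δ hδ).2.2) (fun δ hδ => (hT' χ hχ δ hδ).2.2)
  have hθ0eq : θ 0 = θ₀ := by
    funext x
    have hx : totalEnergyDensity (ρ 0 x) (u 0 x) (θ 0 x) = totalEnergyDensity (ρ₀' x) (u₀ x) (θ₀ x) :=
      congrFun hE x
    rw [hρ, hu0] at hx
    unfold totalEnergyDensity at hx
    have hr := hρ0' x
    have : ρ₀' x * (3 / 2 * θ 0 x) = ρ₀' x * (3 / 2 * θ₀ x) := by nlinarith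
    have h3 := mul_left_cancel₀ hr.ne' this
    linarith
  exact ⟨hρpos, hu0, hθ0eq⟩

end Summit.AtomisticToContinuum.HydrodynamicLimit.Theorems.LocalSecondLawContact

end
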